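import Literature.MathematicalPhysics.QuantumLattice.SpinGaugedBlockCalculus
import Literature.MathematicalPhysics.QuantumLattice.SectorVariationalBounds
import HarnessLib

/-!
# Electric positivity, magnetic weights and block ground states of the spin-gauged Hubbard torus

Family `hubbard` (trunk T-QLATTICE). The three elementary inputs of the `g → 0⁺` (large magnetic
weight) analysis of `spinGaugedHubbardTorusWith ρ L U gE gB` (`SpinGaugedHubbardTorus`), in the
conventions `⟨v, w⟩ = star v ⬝ᵥ w`, energies `Re ⟨v, A v⟩`:

* ELECTRIC POSITIVITY: `1 ⊗ E_b` is a projector (`one_kronecker_electricLink_posSemidef`), hence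
  `Re ⟨Ψ, (1 ⊗ Σ_b E_b) Ψ⟩ ≥ 0` (`re_electric_form_nonneg`); on a state living on ONE link configuration
  `k₀` the value of `1 ⊗ X` is `X k₀ k₀ · ‖φ₀‖²` (`star_dotProduct_one_kronecker_mulVec_single`);
* MAGNETIC WEIGHTS for `Q₈`: `1 - ½ tr ρ(u) ∈ {0, 1, 2}` with `0` iff `u = 1` (`Q8.plaquetteWeight_rep`),
  so the magnetic energy density of a configuration is a natural number, `≥ 1` unless the
  configuration is FLAT (all holonomies trivial) and `0` if it is (`q8_magnetic_diag`); the magnetic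
  form is `Σ_k m(k) ‖Ψ_k‖²` (`star_dotProduct_one_kronecker_magnetic_mulVec`), nonnegative and
  dominating `‖Ψ_k‖²` at every non-flat `k` (`q8_re_magnetic_form_nonneg`,
  `q8_norm_sq_link_le_magnetic_form`);
* BLOCK GROUND STATES: a normalised ground state of the `N`-particle block of `H` with its Rayleigh
  bound (`exists_groundState_cardBlock`), and of the `N`-particle sector of each frozen-link block
  `H_F(k) = A|_{(·,k)(·,k)}` (`exists_unit_groundState_frozen`, `frozen_minEnergyOn_le_rayleigh`), from
  `sector_groundState`.

No definitions; all statements are folklore (Kogut–Susskind, PRD 11 (1975) 395 §§III–IV for the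
electric/magnetic terms; Tasaki (2020) §2.1 for the variational principle).

## Mathlib / tree search

Mathlib: `Matrix.posSemidef_conjTranspose_mul_self`, `Matrix.PosSemidef.dotProduct_mulVec_nonneg`,
`Complex.nonneg_iff`. Tree (REUSED): `electricLink_mul_self`, `electricLink_isHermitian`,
`kronecker_sum`, `kronecker_diagonal_eq_linkDiag`, `Q8.rep_eq_map`, `Q8.repGI_trace_mem`,
`sector_groundState`, `exists_smul_unit`, `rayleigh_of_unit`, `star_dotProduct_linkDiag_mulVec`,
`spinGaugedHubbardTorusWith_apply_of_card_ne`.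
-/

noncomputable section

namespace Literature.MathematicalPhysics.QuantumLattice

open Matrix Finset GaugedHubbard
open scoped Kronecker ComplexOrder

namespace SpinGauged

/-! ### Electric positivity -/

section Electric

variable {G : Type*} [Fintype G] [DecidableEq G] (L : ℕ)

/-- On a state `Φ = φ₀ ⊗ |k₀⟩` living on one link configuration, `⟨Φ, (1 ⊗ X) Φ⟩ = X k₀ k₀ ⟨φ₀, φ₀⟩`.
[folklore] -/
theorem star_dotProduct_one_kronecker_mulVec_single (X : Matrix (Bond L → G) (Bond L → G) ℂ)
    (k₀ : Bond L → G) (φ₀ : Fock (Orb (FermionTorus 2 L))) :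
    star (fun ik : Index L G => if ik.2 = k₀ then φ₀ ik.1 else 0) ⬝ᵥ
        ((1 : Matrix (Finset (Orb (FermionTorus 2 L))) (Finset (Orb (FermionTorus 2 L))) ℂ) ⊗ₖ X) *ᵥ
          (fun ik : Index L G => if ik.2 = k₀ then φ₀ ik.1 else 0) =
      X k₀ k₀ * (star φ₀ ⬝ᵥ φ₀) := by
  -- the matrix–vector product
  have hmv : ∀ ik : Index L G, (((1 : Matrix (Finset (Orb (FermionTorus 2 L))) (Finset (Orb (FermionTorus 2 L))) ℂ) ⊗ₖ X) *ᵥ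
      (fun ik : Index L G => if ik.2 = k₀ then φ₀ ik.1 else 0)) ik = X ik.2 k₀ * φ₀ ik.1 := by
    intro ik
    rw [mulVec, dotProduct, Fintype.sum_prod_type]
    rw [Finset.sum_eq_single ik.1]
    · rw [Finset.sum_eq_single k₀]
      · simp
      · intro k _ hk
        simp [hk]
      · intro h
        exact absurd (Finset.mem_univ _) h
    · intro s _ hs
      refine Finset.sum_eq_zero fun k _ => ?_
      simp [Ne.symm hs]
    · intro h
      exact absurd (Finset.mem_univ _) h
  rw [dotProduct, Fintype.sum_prod_type, dotProduct, Finset.mul_sum]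
  refine Finset.sum_congr rfl fun s _ => ?_
  rw [Finset.sum_eq_single k₀]
  · rw [hmv]
    simp only [Pi.star_apply, if_true]
    ring
  · intro k _ hk
    simp [hk]
  · intro h
    exact absurd (Finset.mem_univ _) h

/-- On a state `Φ = φ₀ ⊗ |k₀⟩`, `⟨Φ, Φ⟩ = ⟨φ₀, φ₀⟩`. [folklore] -/
theorem star_dotProduct_single_self (k₀ : Bond L → G) (φ₀ : Fock (Orb (FermionTorus 2 L))) :
    star (fun ik : Index L G => if ik.2 = k₀ then φ₀ ik.1 else 0) ⬝ᵥ
        (fun ik : Index L G => if ik.2 = k₀ then φ₀ ik.1 else 0) = star φ₀ ⬝ᵥ φ₀ := by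
  have h := star_dotProduct_one_kronecker_mulVec_single L (1 : Matrix (Bond L → G) (Bond L → G) ℂ) k₀ φ₀
  rwa [one_kronecker_one, one_mulVec, one_apply_eq, one_mul] at h

omit [Fintype G] in
/-- The `k`-components of a state `Φ = φ₀ ⊗ |k₀⟩`: `Φ_{k₀} = φ₀` and `Φ_k = 0` for `k ≠ k₀`.
[folklore] -/
theorem single_link_component (k₀ k : Bond L → G) (φ₀ : Fock (Orb (FermionTorus 2 L))) :
    (fun s => (fun ik : Index L G => if ik.2 = k₀ then φ₀ ik.1 else 0) (s, k)) =
      if k = k₀ then φ₀ else 0 := by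
  funext s
  by_cases hk : k = k₀ <;> simp [hk]

/-- On a state `Φ = φ₀ ⊗ |k₀⟩`, a block-diagonal operator sees only the block at `k₀`:
`⟨Φ, (Σ_k S(k) ⊗ |k⟩⟨k|) Φ⟩ = ⟨φ₀, S(k₀) φ₀⟩`. [folklore] -/
theorem star_dotProduct_single_linkDiag_mulVec
    (S : (Bond L → G) → Matrix (Finset (Orb (FermionTorus 2 L))) (Finset (Orb (FermionTorus 2 L))) ℂ)
    (k₀ : Bond L → G) (φ₀ : Fock (Orb (FermionTorus 2 L))) :
    star (fun ik : Index L G => if ik.2 = k₀ then φ₀ ik.1 else 0) ⬝ᵥ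
        linkDiag S *ᵥ (fun ik : Index L G => if ik.2 = k₀ then φ₀ ik.1 else 0) =
      star φ₀ ⬝ᵥ S k₀ *ᵥ φ₀ := by
  rw [star_dotProduct_linkDiag_mulVec, Finset.sum_eq_single k₀]
  · rw [single_link_component, if_pos rfl]
  · intro k _ hk
    rw [single_link_component, if_neg hk, mulVec_zero, dotProduct_zero]
  · intro h
    exact absurd (Finset.mem_univ _) h

variable [Nonempty G]

/-- **`1 ⊗ E_b` is a projector** (Hermitian idempotent), hence positive semidefinite. [folklore] -/
theorem one_kronecker_electricLink_posSemidef (b : Bond L) :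
    ((1 : Matrix (Finset (Orb (FermionTorus 2 L))) (Finset (Orb (FermionTorus 2 L))) ℂ) ⊗ₖ
      (electricLink L b : Matrix (Bond L → G) _ ℂ)).PosSemidef := by
  have hQ : ((1 : Matrix (Finset (Orb (FermionTorus 2 L))) (Finset (Orb (FermionTorus 2 L))) ℂ) ⊗ₖ
        (electricLink L b : Matrix (Bond L → G) _ ℂ))ᴴ *
      ((1 : Matrix (Finset (Orb (FermionTorus 2 L))) (Finset (Orb (FermionTorus 2 L))) ℂ) ⊗ₖ (electricLink L b : Matrix (Bond L → G) _ ℂ)) =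
      (1 : Matrix (Finset (Orb (FermionTorus 2 L))) (Finset (Orb (FermionTorus 2 L))) ℂ) ⊗ₖ (electricLink L b : Matrix (Bond L → G) _ ℂ) := by
    rw [conjTranspose_kronecker, conjTranspose_one, (electricLink_isHermitian L b).eq,
      ← mul_kronecker_mul, Matrix.one_mul, electricLink_mul_self]
  rw [← hQ]
  exact posSemidef_conjTranspose_mul_self _

/-- **The electric energy is nonnegative**: `Re ⟨Ψ, (1 ⊗ Σ_b E_b) Ψ⟩ ≥ 0`. Kogut–Susskind (1975) §III.
[folklore] -/
theorem re_electric_form_nonneg (Ψ : Index L G → ℂ) :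
    0 ≤ (star Ψ ⬝ᵥ ((1 : Matrix (Finset (Orb (FermionTorus 2 L))) (Finset (Orb (FermionTorus 2 L))) ℂ) ⊗ₖ
      (electric L : Matrix (Bond L → G) _ ℂ)) *ᵥ Ψ).re := by
  unfold electric
  rw [kronecker_sum, Matrix.sum_mulVec, dotProduct_sum, Complex.re_sum]
  refine Finset.sum_nonneg fun b _ => ?_
  exact (Complex.nonneg_iff.1
    ((one_kronecker_electricLink_posSemidef L b).dotProduct_mulVec_nonneg Ψ)).1

end Electric

/-! ### Magnetic weights for `Q₈` -/

section Magnetic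

/-- **The magnetic weight of a `Q₈` holonomy is `0`, `1` or `2`, and `0` iff the holonomy is trivial**:
`1 - ½ tr ρ(u) = n` with `n ≤ 2`, `n ≥ 1` for `u ≠ 1`, `n = 0` for `u = 1` (`tr ρ ∈ {2, 0, -2}`,
`tr ρ(u) = 2 ↔ u = 1`). [folklore] -/
theorem Q8.plaquetteWeight_rep (u : Q8) :
    ∃ n : ℕ, plaquetteWeight Q8.rep u = (n : ℂ) ∧ n ≤ 2 ∧ (u ≠ 1 → 1 ≤ n) ∧ (u = 1 → n = 0) := by
  have htr : Q8.rep u 0 0 + Q8.rep u 1 1 = GaussianInt.toComplex (Q8.repGI u 0 0 + Q8.repGI u 1 1) := by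
    rw [map_add, Q8.rep_eq_map]
    rfl
  obtain ⟨hmem, hiff⟩ := Q8.repGI_trace_mem u
  rw [plaquetteWeight, htr]
  rcases hmem with h2 | h2 | h0
  · refine ⟨0, ?_, by norm_num, fun hu => absurd (hiff.1 h2) hu, fun _ => rfl⟩
    rw [h2, map_ofNat]
    norm_num
  · refine ⟨2, ?_, le_rfl, fun _ => by norm_num, fun hu => ?_⟩
    · rw [h2, map_neg, map_ofNat]
      norm_num
    · exfalso
      have := hiff.2 hu
      rw [h2] at this
      exact absurd this (by decide)
  · refine ⟨1, ?_, by norm_num, fun _ => le_rfl, fun hu => ?_⟩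
    · rw [h0, map_zero]
      norm_num
    · exfalso
      have := hiff.2 hu
      rw [h0] at this
      exact absurd this (by decide)

variable (L : ℕ) [NeZero L]

/-- **The magnetic energy density of a `Q₈` configuration is a natural number, `≥ 1` unless the
configuration is flat, and `0` if it is flat.** [folklore] -/
theorem q8_magnetic_diag (k : Bond L → Q8) :
    ∃ n : ℕ, (∑ x : FermionTorus 2 L, plaquetteWeight Q8.rep (holonomy L k x)) = (n : ℂ) ∧
      ((∃ x, holonomy L k x ≠ 1) → 1 ≤ n) ∧ ((∀ x, holonomy L k x = 1) → n = 0) := by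
  choose f hf hle hpos hzero using fun x : FermionTorus 2 L => Q8.plaquetteWeight_rep (holonomy L k x)
  refine ⟨∑ x, f x, ?_, ?_, ?_⟩
  · rw [Nat.cast_sum]
    exact Finset.sum_congr rfl fun x _ => hf x
  · rintro ⟨x, hx⟩
    exact le_trans (hpos x hx) (Finset.single_le_sum (fun y _ => Nat.zero_le (f y)) (Finset.mem_univ x))
  · intro h
    exact Finset.sum_eq_zero fun x _ => hzero x (h x)

variable {G : Type*} [Group G] [Fintype G] [DecidableEq G] (ρ : G →* Matrix (Fin 2) (Fin 2) ℂ)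

/-- **The magnetic form decomposes over link configurations**:
`⟨Ψ, (1 ⊗ Σ_p w_p) Ψ⟩ = Σ_k m(k) ⟨Ψ_k, Ψ_k⟩`, `m(k) = Σ_p w(hol_p(k))`. [folklore] -/
theorem star_dotProduct_one_kronecker_magnetic_mulVec (Ψ : Index L G → ℂ) :
    star Ψ ⬝ᵥ ((1 : Matrix (Finset (Orb (FermionTorus 2 L))) (Finset (Orb (FermionTorus 2 L))) ℂ) ⊗ₖ magnetic ρ L) *ᵥ Ψ =
      ∑ k : Bond L → G, (∑ x : FermionTorus 2 L, plaquetteWeight ρ (holonomy L k x)) *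
        (star (fun s => Ψ (s, k)) ⬝ᵥ fun s => Ψ (s, k)) := by
  unfold magnetic
  rw [kronecker_diagonal_eq_linkDiag, star_dotProduct_linkDiag_mulVec]
  refine Finset.sum_congr rfl fun k _ => ?_
  rw [smul_mulVec, one_mulVec, dotProduct_smul, smul_eq_mul]

/-- The `Q₈` magnetic form is nonnegative. [folklore] -/
theorem q8_re_magnetic_form_nonneg (Ψ : Index L Q8 → ℂ) :
    0 ≤ (star Ψ ⬝ᵥ ((1 : Matrix (Finset (Orb (FermionTorus 2 L))) (Finset (Orb (FermionTorus 2 L))) ℂ) ⊗ₖ magnetic Q8.rep L) *ᵥ Ψ).re := by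
  rw [star_dotProduct_one_kronecker_magnetic_mulVec, Complex.re_sum]
  refine Finset.sum_nonneg fun k _ => ?_
  obtain ⟨n, hn, -, -⟩ := q8_magnetic_diag L k
  rw [hn, ← Complex.ofReal_natCast, Complex.re_ofReal_mul]
  exact mul_nonneg (Nat.cast_nonneg n) (EigenvalueContinuation.re_star_dotProduct_self_nonneg _)

/-- **The `Q₈` magnetic form dominates the weight on every non-flat configuration**:
`‖Ψ_k‖² ≤ Re ⟨Ψ, (1 ⊗ Σ_p w_p) Ψ⟩` whenever some holonomy of `k` is non-trivial. [folklore] -/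
theorem q8_norm_sq_link_le_magnetic_form (Ψ : Index L Q8 → ℂ) (k : Bond L → Q8)
    (hk : ∃ x, holonomy L k x ≠ 1) :
    (star (fun s => Ψ (s, k)) ⬝ᵥ fun s => Ψ (s, k)).re ≤
      (star Ψ ⬝ᵥ ((1 : Matrix (Finset (Orb (FermionTorus 2 L))) (Finset (Orb (FermionTorus 2 L))) ℂ) ⊗ₖ magnetic Q8.rep L) *ᵥ Ψ).re := by
  rw [star_dotProduct_one_kronecker_magnetic_mulVec, Complex.re_sum]
  have hterm : ∀ k' : Bond L → Q8, 0 ≤ ((∑ x : FermionTorus 2 L, plaquetteWeight Q8.rep (holonomy L k' x)) *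
      (star (fun s => Ψ (s, k')) ⬝ᵥ fun s => Ψ (s, k'))).re := by
    intro k'
    obtain ⟨n, hn, -, -⟩ := q8_magnetic_diag L k'
    rw [hn, ← Complex.ofReal_natCast, Complex.re_ofReal_mul]
    exact mul_nonneg (Nat.cast_nonneg n) (EigenvalueContinuation.re_star_dotProduct_self_nonneg _)
  refine le_trans ?_ (Finset.single_le_sum (fun k' _ => hterm k') (Finset.mem_univ k))
  obtain ⟨n, hn, hpos, -⟩ := q8_magnetic_diag L k
  rw [hn, ← Complex.ofReal_natCast, Complex.re_ofReal_mul]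
  have h1 : (1 : ℝ) ≤ n := by exact_mod_cast hpos hk
  have h0 := EigenvalueContinuation.re_star_dotProduct_self_nonneg (fun s => Ψ (s, k))
  nlinarith

/-- **The `Q₈` magnetic form dominates the total weight on the non-flat configurations**:
`Σ_{k not flat} ‖Ψ_k‖² ≤ Re ⟨Ψ, (1 ⊗ Σ_p w_p) Ψ⟩`. [folklore] -/
theorem q8_sum_nonflat_norm_sq_le_magnetic_form (Ψ : Index L Q8 → ℂ) :
    ∑ k ∈ Finset.univ.filter (fun k : Bond L → Q8 => ¬ ∀ x, holonomy L k x = 1),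
        (star (fun s => Ψ (s, k)) ⬝ᵥ fun s => Ψ (s, k)).re ≤
      (star Ψ ⬝ᵥ ((1 : Matrix (Finset (Orb (FermionTorus 2 L))) (Finset (Orb (FermionTorus 2 L))) ℂ) ⊗ₖ magnetic Q8.rep L) *ᵥ Ψ).re := by
  rw [star_dotProduct_one_kronecker_magnetic_mulVec, Complex.re_sum]
  have hterm : ∀ k' : Bond L → Q8, 0 ≤ ((∑ x : FermionTorus 2 L, plaquetteWeight Q8.rep (holonomy L k' x)) *
      (star (fun s => Ψ (s, k')) ⬝ᵥ fun s => Ψ (s, k'))).re := by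
    intro k'
    obtain ⟨n, hn, -, -⟩ := q8_magnetic_diag L k'
    rw [hn, ← Complex.ofReal_natCast, Complex.re_ofReal_mul]
    exact mul_nonneg (Nat.cast_nonneg n) (EigenvalueContinuation.re_star_dotProduct_self_nonneg _)
  refine le_trans ?_ (Finset.sum_le_sum_of_subset_of_nonneg
    (Finset.filter_subset (fun k : Bond L → Q8 => ¬ ∀ x, holonomy L k x = 1) Finset.univ)
    (fun k' _ _ => hterm k'))
  refine Finset.sum_le_sum fun k hk => ?_
  rw [Finset.mem_filter] at hk
  obtain ⟨n, hn, hpos, -⟩ := q8_magnetic_diag L k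
  rw [hn, ← Complex.ofReal_natCast, Complex.re_ofReal_mul]
  have h1 : (1 : ℝ) ≤ n := by exact_mod_cast hpos (not_forall.1 hk.2)
  have h0 := EigenvalueContinuation.re_star_dotProduct_self_nonneg (fun s => Ψ (s, k))
  nlinarith

/-- The magnetic energy density vanishes on a flat `Q₈` configuration. [folklore] -/
theorem q8_magnetic_diag_eq_zero_of_flat (k : Bond L → Q8) (hk : ∀ x, holonomy L k x = 1) :
    (∑ x : FermionTorus 2 L, plaquetteWeight Q8.rep (holonomy L k x)) = 0 :=
  Finset.sum_eq_zero fun x _ => by rw [hk x, plaquetteWeight_one]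

end Magnetic

/-! ### Ground states of particle-number blocks -/

section GroundStates

variable {G : Type*} [Group G] [Fintype G] [DecidableEq G]
variable (ρ : G →* Matrix (Fin 2) (Fin 2) ℂ) (L : ℕ) [NeZero L]

/-- **A normalised ground state of the `N`-particle block of the coupled system**, with its Rayleigh
bound on the block: `H Ψ = E Ψ`, `‖Ψ‖ = 1`, `E ‖Φ‖² ≤ Re ⟨Φ, H Φ⟩` for every `Φ` in the block
(`sector_groundState` for the coordinate sector `#s = N`, which `H` leaves invariant). [folklore] -/
theorem exists_groundState_cardBlock (hρ : ∀ h : G, star (ρ h 0 0 + ρ h 1 1) = ρ h 0 0 + ρ h 1 1)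
    (U gE gB : ℝ) {N : ℕ} (hN : ∃ s : Finset (Orb (FermionTorus 2 L)), s.card = N) :
    ∃ Ψ : Index L G → ℂ, (∀ ik : Index L G, ik.1.card ≠ N → Ψ ik = 0) ∧ star Ψ ⬝ᵥ Ψ = 1 ∧
      ∃ E : ℝ, spinGaugedHubbardTorusWith ρ L U gE gB *ᵥ Ψ = (E : ℂ) • Ψ ∧
        ∀ Φ : Index L G → ℂ, (∀ ik : Index L G, ik.1.card ≠ N → Φ ik = 0) →
          E * (star Φ ⬝ᵥ Φ).re ≤ (star Φ ⬝ᵥ spinGaugedHubbardTorusWith ρ L U gE gB *ᵥ Φ).re := by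
  classical
  set H := spinGaugedHubbardTorusWith ρ L U gE gB with hH
  let K : Submodule ℂ (Index L G → ℂ) :=
    { carrier := {v | ∀ ik : Index L G, ¬ ik.1.card = N → v ik = 0}
      add_mem' := fun {v w} hv hw ik hik => by simp [Pi.add_apply, hv ik hik, hw ik hik]
      zero_mem' := fun _ _ => rfl
      smul_mem' := fun c v hv ik hik => by simp [hv ik hik] }
  have hK : ∀ v, v ∈ K ↔ ∀ ik : Index L G, ¬ ik.1.card = N → v ik = 0 := fun v => Iff.rfl
  obtain ⟨s₀, hs₀⟩ := hN
  have hp : ∃ ik : Index L G, ik.1.card = N := ⟨(s₀, fun _ => 1), hs₀⟩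
  have hinv : ∀ i j : Index L G, ¬ i.1.card = N → j.1.card = N → H i j = 0 := by
    intro i j hi hj
    obtain ⟨s, k⟩ := i
    obtain ⟨s', k'⟩ := j
    exact spinGaugedHubbardTorusWith_apply_of_card_ne ρ L U gE gB (by rw [hj]; exact hi) k k'
  have hHerm : H.IsHermitian := isHermitian_spinGaugedHubbardTorusWith ρ L hρ U gE gB
  obtain ⟨⟨v, hvK, hv0, hv⟩, hray⟩ :=
    sector_groundState H hHerm (fun ik : Index L G => ik.1.card = N) hp hinv K hK
  obtain ⟨c, hc, hunit⟩ := exists_smul_unit hv0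
  refine ⟨c • v, fun ik hik => by simp [(hK v).1 hvK ik hik], hunit, H.minEnergyOn K, ?_, ?_⟩
  · rw [mulVec_smul, hv, smul_comm]
  · intro Φ hΦ
    exact rayleigh_of_unit (p := fun ik : Index L G => ik.1.card = N)
      (fun w hw hw1 => hray w ((hK w).2 hw) hw1) Φ hΦ

/-- **A normalised ground state of the `N`-particle sector of a frozen-link block** `H_F(k)`:
`H_F(k) φ = e₀(k) φ`, `‖φ‖ = 1`, `e₀(k) = minEnergyOn (H_F k) (N-particle sector)`. [folklore] -/
theorem exists_unit_groundState_frozen (hρ : ∀ h : G, star (ρ h 0 0 + ρ h 1 1) = ρ h 0 0 + ρ h 1 1)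
    (U : ℝ) (k : Bond L → G) {N : ℕ} (hN : ∃ s : Finset (Orb (FermionTorus 2 L)), s.card = N) :
    ∃ φ : Fock (Orb (FermionTorus 2 L)),
      φ ∈ (nParticleSubmodule N : Submodule ℂ (Fock (Orb (FermionTorus 2 L)))) ∧ star φ ⬝ᵥ φ = 1 ∧
      (spinGaugedHubbardTorusWith ρ L U 0 0).submatrix (fun s => (s, k)) (fun s => (s, k)) *ᵥ φ =
        ((((spinGaugedHubbardTorusWith ρ L U 0 0).submatrix (fun s => (s, k)) (fun s => (s, k))).minEnergyOn
          (nParticleSubmodule N : Submodule ℂ (Fock (Orb (FermionTorus 2 L)))) : ℝ) : ℂ) • φ := by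
  classical
  set HF := (spinGaugedHubbardTorusWith ρ L U 0 0).submatrix (fun s => (s, k)) (fun s => (s, k)) with hHF
  have hHerm : HF.IsHermitian := (isHermitian_spinGaugedHubbardTorusWith ρ L hρ U 0 0).submatrix _
  have hinv : ∀ s s' : Finset (Orb (FermionTorus 2 L)), ¬ s.card = N → s'.card = N → HF s s' = 0 := by
    intro s s' hs hs'
    rw [hHF, submatrix_apply]
    exact spinGaugedHubbardTorusWith_apply_of_card_ne ρ L U 0 0 (by rw [hs']; exact hs) k k
  have hK : ∀ v : Fock (Orb (FermionTorus 2 L)),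
      v ∈ (nParticleSubmodule N : Submodule ℂ (Fock (Orb (FermionTorus 2 L)))) ↔
        ∀ s, ¬ s.card = N → v s = 0 := fun v => Iff.rfl
  obtain ⟨⟨v, hvK, hv0, hv⟩, -⟩ :=
    sector_groundState HF hHerm (fun s : Finset (Orb (FermionTorus 2 L)) => s.card = N) hN hinv _ hK
  obtain ⟨c, hc, hunit⟩ := exists_smul_unit hv0
  refine ⟨c • v, Submodule.smul_mem _ _ hvK, hunit, ?_⟩
  rw [mulVec_smul, hv, smul_comm]

/-- **The frozen-link sector energy bounds the Rayleigh quotient on the sector**: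
`e₀(k) ‖φ‖² ≤ Re ⟨φ, H_F(k) φ⟩` for every `N`-particle `φ`. [folklore] -/
theorem frozen_minEnergyOn_le_rayleigh (hρ : ∀ h : G, star (ρ h 0 0 + ρ h 1 1) = ρ h 0 0 + ρ h 1 1)
    (U : ℝ) (k : Bond L → G) {N : ℕ} (hN : ∃ s : Finset (Orb (FermionTorus 2 L)), s.card = N)
    (φ : Fock (Orb (FermionTorus 2 L)))
    (hφ : φ ∈ (nParticleSubmodule N : Submodule ℂ (Fock (Orb (FermionTorus 2 L))))) :
    ((spinGaugedHubbardTorusWith ρ L U 0 0).submatrix (fun s => (s, k)) (fun s => (s, k))).minEnergyOn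
        (nParticleSubmodule N : Submodule ℂ (Fock (Orb (FermionTorus 2 L)))) * (star φ ⬝ᵥ φ).re ≤
      (star φ ⬝ᵥ (spinGaugedHubbardTorusWith ρ L U 0 0).submatrix (fun s => (s, k)) (fun s => (s, k)) *ᵥ
        φ).re := by
  classical
  set HF := (spinGaugedHubbardTorusWith ρ L U 0 0).submatrix (fun s => (s, k)) (fun s => (s, k)) with hHF
  have hHerm : HF.IsHermitian := (isHermitian_spinGaugedHubbardTorusWith ρ L hρ U 0 0).submatrix _
  have hinv : ∀ s s' : Finset (Orb (FermionTorus 2 L)), ¬ s.card = N → s'.card = N → HF s s' = 0 := by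
    intro s s' hs hs'
    rw [hHF, submatrix_apply]
    exact spinGaugedHubbardTorusWith_apply_of_card_ne ρ L U 0 0 (by rw [hs']; exact hs) k k
  have hK : ∀ v : Fock (Orb (FermionTorus 2 L)),
      v ∈ (nParticleSubmodule N : Submodule ℂ (Fock (Orb (FermionTorus 2 L)))) ↔
        ∀ s, ¬ s.card = N → v s = 0 := fun v => Iff.rfl
  obtain ⟨-, hray⟩ :=
    sector_groundState HF hHerm (fun s : Finset (Orb (FermionTorus 2 L)) => s.card = N) hN hinv _ hK
  exact rayleigh_of_unit (p := fun s : Finset (Orb (FermionTorus 2 L)) => s.card = N)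
    (fun w hw hw1 => hray w ((hK w).2 hw) hw1) φ ((hK φ).1 hφ)

/-- **Rayleigh quotients of a frozen-link block are Rayleigh quotients of the gauge–fermion part**
(on the state `v ⊗ |k⟩`), hence bounded below by its ground energy: `E₀(A) ‖v‖² ≤ Re ⟨v, H_F(k) v⟩`.
[folklore] -/
theorem groundEnergy_gaugeFermion_le_rayleigh_frozen
    (hρ : ∀ h : G, star (ρ h 0 0 + ρ h 1 1) = ρ h 0 0 + ρ h 1 1) (U : ℝ) (k : Bond L → G)
    (v : Fock (Orb (FermionTorus 2 L))) :
    (spinGaugedHubbardTorusWith ρ L U 0 0).groundEnergy * (star v ⬝ᵥ v).re ≤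
      (star v ⬝ᵥ (spinGaugedHubbardTorusWith ρ L U 0 0).submatrix (fun s => (s, k)) (fun s => (s, k)) *ᵥ
        v).re := by
  set A := spinGaugedHubbardTorusWith ρ L U 0 0 with hA
  have hHerm : A.IsHermitian := isHermitian_spinGaugedHubbardTorusWith ρ L hρ U 0 0
  -- the Rayleigh quotient of `A` at `v ⊗ |k⟩`
  have hform : star (fun ik : Index L G => if ik.2 = k then v ik.1 else 0) ⬝ᵥ
      A *ᵥ (fun ik : Index L G => if ik.2 = k then v ik.1 else 0) =
      star v ⬝ᵥ A.submatrix (fun s => (s, k)) (fun s => (s, k)) *ᵥ v := by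
    conv_lhs => rw [hA, spinGaugedHubbardTorusWith_zero_zero_eq_linkDiag_submatrix ρ L U]
    rw [star_dotProduct_single_linkDiag_mulVec]
  have hnorm := star_dotProduct_single_self L k v
  have h := rayleigh_of_unit (p := fun _ : Index L G => True)
    (fun w _ hw1 => Matrix.groundEnergy_le_rayleigh_holds hHerm w hw1)
    (fun ik : Index L G => if ik.2 = k then v ik.1 else 0) (fun _ h => absurd trivial h)
  rwa [hform, hnorm] at h

end GroundStates

end SpinGauged

end Literature.MathematicalPhysics.QuantumLattice

end
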